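import Literature.NumberTheory.EllipticCurves.KrizLi2019.EisensteinHeegnerLog
import HarnessLib

/-!
# Route `PrintCFram`, crux C2 `BottomClassIndexLawFiveLe` (stmt-BirchSwinnertonDyer-20372), line `eisenstein-resource-bdp-line`
# (registry v6): Kriz–Li's Bernoulli pair for an ODD character `ψ` — the first factor is `B_{1,ψ⁻¹}`, independent
# of the Heegner field

Cell `bsd-print-cfram`, width seat `bsd-line-cfram-p1-w2` (generation g4); helper `--supports stmt-BirchSwinnertonDyer-20372`.
THEOREMS ONLY (0 definitions, 0 named facts, 0 instances, no `sorry`). BSD is not proved by any of this; no summit statement is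
proved by this seat.

## Why
The regular Kriz–Li datum of the v6 skeleton (LEAD g5) carries Kriz–Li 2019 Thm. 1.20's hypothesis (4)
`B_{1,ψ₀⁻¹ε_K} · B_{1,ψ₀ω⁻¹} ≢ 0 (mod p)` with `ψ₀ = ψ` if `ψ` is even and `ψ₀ = ψε_K` if `ψ` is odd (tree: `evenTwist`,
`bernoulliCharOne`, `bernoulliCharTwo`, `bernoulliOnePrim`). On the CM-ramified rank-one window `ψ = χ_d·ω^{(p+1)/4}` is ODD in
all 65 classes (w2 g4 census `Lines/eisenstein-resource-bdp-line-w2g4-kl4-census.md`: `ψ(−1) = w(W) = −1`), and then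
`ψ₀⁻¹ε_K = ψ⁻¹ε_K⁻¹ε_K = ψ⁻¹`: the FIRST Bernoulli number is `B_{1,ψ⁻¹}`, a number attached to `(W, p)` ALONE — so (4) splits
into a CLASS factor `p ∤ B_{1,ψ⁻¹}` (which fails exactly on the two level-1 cells 17424bl1@11, 305809c1@7 of the census) and a
`K''`-factor `p ∤ B_{1,ψε_Kω⁻¹}`. This file is the kernel form of that bookkeeping, for ANY odd `ψ` (no quadraticity of `ε_K`
is needed: `ε_K⁻¹ε_K = 1`).

* `bernoulliCharOne_of_not_even` — `ψ` odd ⟹ `bernoulliCharOne ψ εK = (ψ⁻¹)↑` (lift to level `f·|d_K|`);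
* `bernoulliCharTwo_of_not_even` — `ψ` odd ⟹ `bernoulliCharTwo ψ εK ω = (ψ↑·εK↑)↑ · (ω⁻¹)↑`;
* `generalizedBernoulli_congr` / `bernoulliOnePrim_changeLevel` — `B_{1,·}` of the primitive character is invariant under
  `changeLevel` (Mathlib `conductor_changeLevel`, `primitiveCharacter_changeLevel_apply`);
* **`bernoulliOnePrim_bernoulliCharOne_of_not_even`** — `ψ` odd ⟹ `bernoulliOnePrim (bernoulliCharOne ψ εK) = bernoulliOnePrim ψ⁻¹`;
* `krizLi_bernoulli_hypothesis_iff_of_not_even` — for odd `ψ`, hypothesis (4) in the tree's reading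
  `¬ ‖B·B'‖ ≤ p⁻¹` ⟺ `¬ ‖bernoulliOnePrim ψ⁻¹ · bernoulliOnePrim (bernoulliCharTwo ψ εK ω)‖ ≤ p⁻¹`.

References: Kriz–Li, Forum Math. Sigma 7 (2019) e15, §1.5 (1), Thm. 1.20 (pp. 7–8); Washington, *Cyclotomic Fields* §4
(generalized Bernoulli numbers); Diamond–Shurman §4.7 (4.30).
-/

set_option autoImplicit false
-- the summit namespace `Summit.BirchSwinnertonDyer.BirchSwinnertonDyer` repeats the problem name by design (D-0017)
set_option linter.dupNamespace false

noncomputable section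

open scoped Classical

namespace Summit.BirchSwinnertonDyer.BirchSwinnertonDyer.Theorems.PrintCFram.RegularLocusBernoulliPair

open Literature.NumberTheory.EllipticCurves.KrizLi2019 Literature.NumberTheory.LFunctions DirichletCharacter

variable {p : ℕ} [Fact p.Prime] {f d : ℕ}

/-- **`ψ` odd ⟹ `ψ₀⁻¹ε_K = ψ⁻¹`** (lifted to level `f·|d_K|`): `ψ₀ = ψε_K`, so `ψ₀⁻¹ε_K = ψ⁻¹ε_K⁻¹ε_K = ψ⁻¹` — no property
of `ε_K` is used. [cite: KrizLi2019, §1.5 (p. 7) and Thm. 1.20 (p. 8)] -/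
theorem bernoulliCharOne_of_not_even (ψ : DirichletCharacter ℚ_[p] f) (εK : DirichletCharacter ℚ_[p] d)
    (hψ : ¬ ψ.Even) : bernoulliCharOne ψ εK = changeLevel (dvd_mul_right f d) ψ⁻¹ := by
  unfold bernoulliCharOne evenTwist
  rw [if_neg hψ, mul_inv, mul_assoc, inv_mul_cancel, mul_one, map_inv]

/-- **`ψ` odd ⟹ `ψ₀ω⁻¹ = ψ·ε_K·ω⁻¹`** (lifted to level `f·|d_K|·p`). [cite: KrizLi2019, §1.5 (p. 7) and Thm. 1.20 (p. 8)] -/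
theorem bernoulliCharTwo_of_not_even (ψ : DirichletCharacter ℚ_[p] f) (εK : DirichletCharacter ℚ_[p] d)
    (ω : DirichletCharacter ℚ_[p] p) (hψ : ¬ ψ.Even) :
    bernoulliCharTwo ψ εK ω =
      changeLevel (dvd_mul_right (f * d) p)
          (changeLevel (dvd_mul_right f d) ψ * changeLevel (dvd_mul_left d f) εK) *
        changeLevel (dvd_mul_left p (f * d)) ω⁻¹ := by
  unfold bernoulliCharTwo evenTwist
  rw [if_neg hψ]

/-- Generalized Bernoulli numbers only see the values: two characters of the same level with the same values at every
integer have the same `B_{k,·}`. [cite: DiamondShurman2005, §4.7 (4.30), p. 135] -/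
theorem generalizedBernoulli_congr {R : Type*} [CommRing R] [Algebra ℚ R] :
    ∀ {N₁ N₂ : ℕ} [NeZero N₁] [NeZero N₂] (h : N₁ = N₂) (χ₁ : DirichletCharacter R N₁) (χ₂ : DirichletCharacter R N₂),
      (∀ a : ℤ, χ₁ a = χ₂ a) → ∀ k : ℕ, generalizedBernoulli k χ₁ = generalizedBernoulli k χ₂ := by
  intro N₁ N₂ _ _ h χ₁ χ₂ hval k
  subst h
  have hχ : χ₁ = χ₂ := by
    apply MulChar.ext
    intro a
    have h := hval (((a : ZMod N₁).val : ℕ) : ℤ)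
    rwa [Int.cast_natCast, ZMod.natCast_zmod_val] at h
  rw [hχ]

/-- **`B_{1,·}` of the primitive character is invariant under `changeLevel`** (Mathlib: `conductor_changeLevel`,
`primitiveCharacter_changeLevel_apply`). [cite: DiamondShurman2005, §4.7 (4.30), p. 135] -/
theorem bernoulliOnePrim_changeLevel {n m : ℕ} [NeZero n] [NeZero m] (hm : n ∣ m) (χ : DirichletCharacter ℚ_[p] n) :
    bernoulliOnePrim (changeLevel hm χ) = bernoulliOnePrim χ := by
  rw [bernoulliOnePrim_def, bernoulliOnePrim_def]
  haveI : NeZero (changeLevel hm χ).conductor := ⟨conductor_ne_zero _⟩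
  haveI : NeZero χ.conductor := ⟨conductor_ne_zero _⟩
  exact generalizedBernoulli_congr (conductor_changeLevel hm (χ := χ)) _ _
    (fun a ↦ primitiveCharacter_changeLevel_apply hm χ a) 1

/-- **Kriz–Li's FIRST Bernoulli number for an odd `ψ` is `B_{1,ψ⁻¹}`** — independent of the imaginary quadratic field
(on the CM-ramified rank-one window `ψ` is always odd, w2 g4 census). [cite: KrizLi2019, Thm. 1.20 (p. 8)] -/
theorem bernoulliOnePrim_bernoulliCharOne_of_not_even [NeZero f] [NeZero d] (ψ : DirichletCharacter ℚ_[p] f)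
    (εK : DirichletCharacter ℚ_[p] d) (hψ : ¬ ψ.Even) :
    bernoulliOnePrim (bernoulliCharOne ψ εK) = bernoulliOnePrim ψ⁻¹ := by
  rw [bernoulliCharOne_of_not_even ψ εK hψ, bernoulliOnePrim_changeLevel]

/-- **Hypothesis (4) of Thm. 1.20 for an odd `ψ`, split**: in the tree's reading (`¬ ‖B·B'‖ ≤ p⁻¹`) it is the statement
about `B_{1,ψ⁻¹} · B_{1,ψ₀ω⁻¹}` — a CLASS factor times a `K''`-factor. [cite: KrizLi2019, Thm. 1.20 (p. 8)] -/
theorem krizLi_bernoulli_hypothesis_iff_of_not_even [NeZero f] [NeZero d] (ψ : DirichletCharacter ℚ_[p] f)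
    (εK : DirichletCharacter ℚ_[p] d) (ω : DirichletCharacter ℚ_[p] p) (hψ : ¬ ψ.Even) :
    (¬ ‖bernoulliOnePrim (bernoulliCharOne ψ εK) * bernoulliOnePrim (bernoulliCharTwo ψ εK ω)‖ ≤ (p : ℝ)⁻¹) ↔
      ¬ ‖bernoulliOnePrim ψ⁻¹ * bernoulliOnePrim (bernoulliCharTwo ψ εK ω)‖ ≤ (p : ℝ)⁻¹ := by
  rw [bernoulliOnePrim_bernoulliCharOne_of_not_even ψ εK hψ]

/-- **The class factor is necessary**: if `‖B_{1,ψ⁻¹}‖ ≤ p⁻¹` (the class invariant is a NON-unit — the two level-1 cells of the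
census) then, as soon as the second factor is `p`-integral, hypothesis (4) FAILS for that `K''` (so no Kriz–Li datum exists
with this `ψ` over any such field). [cite: KrizLi2019, Thm. 1.20 (p. 8) and Cor. 8.4 (p-integrality of the Bernoulli numbers)] -/
theorem krizLi_bernoulli_hypothesis_fails_of_classFactor [NeZero f] [NeZero d] (ψ : DirichletCharacter ℚ_[p] f)
    (εK : DirichletCharacter ℚ_[p] d) (ω : DirichletCharacter ℚ_[p] p) (hψ : ¬ ψ.Even)
    (hcls : ‖bernoulliOnePrim ψ⁻¹‖ ≤ (p : ℝ)⁻¹) (hint : ‖bernoulliOnePrim (bernoulliCharTwo ψ εK ω)‖ ≤ 1) :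
    ‖bernoulliOnePrim (bernoulliCharOne ψ εK) * bernoulliOnePrim (bernoulliCharTwo ψ εK ω)‖ ≤ (p : ℝ)⁻¹ := by
  rw [bernoulliOnePrim_bernoulliCharOne_of_not_even ψ εK hψ, norm_mul]
  have h0 : (0 : ℝ) ≤ (p : ℝ)⁻¹ := by positivity
  calc ‖bernoulliOnePrim ψ⁻¹‖ * ‖bernoulliOnePrim (bernoulliCharTwo ψ εK ω)‖
      ≤ (p : ℝ)⁻¹ * 1 := mul_le_mul hcls hint (norm_nonneg _) h0
    _ = (p : ℝ)⁻¹ := mul_one _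

end Summit.BirchSwinnertonDyer.BirchSwinnertonDyer.Theorems.PrintCFram.RegularLocusBernoulliPair

end
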